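import Summits.BirchSwinnertonDyer.Rank1Residual.Additive.CyclotomicCharacterOnStableLine
import Summits.BirchSwinnertonDyer.Rank1Residual.GaloisImage.SmallImageTameInertia
import Summits.BirchSwinnertonDyer.Rank1Residual.AdditivePotMult.PStarTwistModel
import Summits.BirchSwinnertonDyer.Rank1Residual.Additive.GordRamifiedOrdinaryLine
import Literature.NumberTheory.GaloisRepresentations.KummerQuadraticCharacterInertia
import HarnessLib

/-!
# TB-TOL: the twisted-ordinary line of `E = E♭ ⊗ χ₋₃` at `3` EXISTS IN THE KERNEL — the per-pair
# shape binder `TwistedOrdinaryLineAt W 3 I_𝔓` of O8-TAME / `inertiaSplitAt_of_congruence` DISCHARGED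
# from the unramified-quotient line of the semistable twist `E♭` (cell `b2b-bsdres`, lane CLASS-CLOSURE,
# seat cc-typer-1 = typer of record N11 / O8; task TB-TOL of `class-closure/O8/STATEMENT.md` §13)

HONEST FRAMING (cell `b2b-bsdres`, run/shared/lean/b2b/bsd-rank1-residual/, verbatim in every
file): the goal of the cell is to DELETE the COMBINATION-SHAPED residual classes of the
Birch–Swinnerton-Dyer formula for ALL analytic-rank `≤ 1` elliptic curves over `ℚ` — "full BSD
formula for every rank `≤ 1` curve in class `C`" assembled STRICTLY from published theorems — so
that the rank-`≤ 1` remainder becomes exactly the CONSTRUCTION-SHAPED classes, which are TYPED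
(missing-input `Prop`s), NOT attempted. This is not "finishing BSD". Lane CLASS-CLOSURE: research
routes, no claim beyond the stated classes; census output = EVIDENCE, never a Literature fact;
NOTHING is booked here. THEOREMS ONLY: no definition, no named fact, no conjecture, no `sorry`.

## What is proved

* Prequel `Additive/CyclotomicCharacterOnStableLine.lean` (same seat): §1 the determinant reads a
  stable line with trivial quotient (`σ|_L = χ̄_p(σ)`), §2 `χ₋₃ = ω` (`σ√−3 = √−3 ↔ χ̄₃(σ) = 1`).
* §3 **TB-TOL** `twistedOrdinaryLineAt_three_of_twist_model` — for `C • V^{(−3)} = W` and an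
  unramified-quotient line of `V[3]` at a subgroup `I` containing an element moving `√−3`
  (`UnramifiedQuotientLineAt V 3 I`; at `I = I_𝔓`, `𝔓 ∣ 3`: `V` GOOD ORDINARY — x1a's Serre line —
  or MULTIPLICATIVE — X2's Tate line), `W[3]` has the TWISTED-ORDINARY shape at `I`
  (`TwistedOrdinaryLineAt W 3 I`): the transported line is FIXED pointwise by `I` (sign `χ₋₃(σ)` ×
  scalar `χ̄₃(σ)` = 1) and a Kummer inertia element `σ₁√−3 = −√−3`
  (`exists_mem_inertia_smul_geomSqrt_eq_neg`) moves the quotient. Class forms at `I_𝔓`: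
  `twistedOrdinaryLineAt_three_of_goodOrd_twist_model` (the `I₀*` rows; NO fact),
  `exists_twistedOrdinaryLineAt_three_of_mult_twist_model` ((M) rows; Tate uniformisation A40/A41 as
  hypotheses, as everywhere in the cell).
* §4 consequences with NO per-pair shape binder: `O8.inertiaSplitAt_three_of_goodOrd_twist_model`,
  `inertiaSplitAt_three_of_classX4Gord_of_not_surj` (O8 ∩ X4♯(G-ord) ∩ `I₀*` at `3`: TAME is an
  UNCONDITIONAL theorem), `O8.exists_inertiaSplitAt_three_of_mult_twist_model` /
  `exists_inertiaSplitAt_three_of_classX4M_of_not_surj` ((M): modulo A40/A41), and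
  `inertiaSplitAt_of_congruence_of_goodOrdinary_of_goodOrd_twist_model` (the `hE` binder of
  cc-typer-1 gen 6's `inertiaSplitAt_of_congruence_of_goodOrdinary`, p258175, discharged).

Consequence (with `GaloisImage/SmallImageTameInertia.lean`): on every O8 (M)/`I₀*` row at `3` the
sub-partition key TAME (`InertiaSplitAt W 3 I_𝔓`) is a theorem with NO per-pair binder left
(`I₀*`: unconditional; (M): modulo A40/A41); and the `hE` binder of cc-typer-1 gen 6's
`MixedCongruence.inertiaSplitAt_of_congruence` (p258175) is discharged on every CERT-2 link.
Nothing about BSD_p; O8 / N10 / N11 marks unchanged; nothing booked.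

References: J.-P. Serre, Invent. Math. 15 (1972) §1.11 (det = cyclotomic character; the ordinary
line) [Serre1972]; J. H. Silverman, *AEC* X.5 Cor. 5.4 (quadratic twist) [SilvermanAEC2009];
S. Lang, *Fundamentals of Diophantine Geometry* Ch. 6 Prop. 1.3 (Kummer) [Lang1983];
class-closure/O8/STATEMENT.md §§12–13.
-/

set_option autoImplicit false

noncomputable section

open scoped Classical NumberField Matrix

open WeierstrassCurve Literature.NumberTheory.EllipticCurves Literature.NumberTheory.GaloisRepresentations
  Field IsDedekindDomain NumberField
  Literature.NumberTheory.EllipticCurves.Rank1Residual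
  Summit.BirchSwinnertonDyer.Rank1Residual.GaloisImage

namespace Summit.BirchSwinnertonDyer.Rank1Residual.Additive.MixedCongruence

variable {W : WeierstrassCurve ℚ} [W.IsElliptic] {p : ℕ} [Fact p.Prime]

/-! ## §3. TB-TOL: the twisted-ordinary line of `W = C • V^{(−3)}` at `3` -/

omit [W.IsElliptic] in
/-- `3 • P = 0` on `E[3]`, so `2 • P = −P`. [folklore] -/
theorem two_zsmul_eq_neg_three (P : geomTorsion W ((3 : ℕ) : ℤ)) : ((2 : ℕ) : ℤ) • P = -P := by
  have h3 : ((3 : ℕ) : ℤ) • P = 0 := natCast_zsmul_eq_zero P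
  have h21 : ((2 : ℕ) : ℤ) + 1 = ((3 : ℕ) : ℤ) := by norm_num
  rw [eq_neg_iff_add_eq_zero, ← h3, ← add_one_zsmul, h21]

omit [W.IsElliptic] in
/-- **TB-TOL (abstract form).** Let `W = C • V^{(−3)}` be a model of the quadratic twist of `V` by
`−3`, `I ≤ Γ_ℚ` a subgroup containing an element moving `√−3`, and `V[3]` of unramified-quotient
shape at `I` (a line `X` with `(σ − 1)V[3] ⊆ X` for `σ ∈ I`: good ordinary / multiplicative primes).
Then `W[3]` has the TWISTED-ORDINARY shape at `I`: the line `L = e⁻¹(X)` (for the sign-equivariant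
`e : W[3] ≃ V[3]`, `e(σT) = χ₋₃(σ) σ e(T)`, Silverman X.5.4) is FIXED pointwise by `I`
(on `X`, `σ = χ̄₃(σ)` by §1 and `χ₋₃ = χ̄₃` by §2, so the two signs cancel), and an element
`σ₁ ∈ I` with `σ₁√−3 = −√−3` acts on `W[3]/L` by `−1 ≠ 1`. This is the per-pair shape binder of
`O8.inertiaSplitAt_of_twistedOrdinaryLineAt` and of `inertiaSplitAt_of_congruence`, as a theorem.
[cite: SilvermanAEC2009, X.5 Cor. 5.4] [cite: Serre1972, §1.11] -/
theorem twistedOrdinaryLineAt_three_of_twist_model {V : WeierstrassCurve ℚ} [V.IsElliptic]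
    (C : VariableChange ℚ) (hC : C • V.quadraticTwist (-3 : ℚ) = W)
    {I : Subgroup (absoluteGaloisGroup ℚ)}
    (hI : ∃ σ₁ ∈ I, σ₁ • geomSqrt (-3 : ℚ) = -geomSqrt (-3 : ℚ))
    (hA : UnramifiedQuotientLineAt V 3 I) : TwistedOrdinaryLineAt W 3 I := by
  have hd0 : (-3 : ℚ) ≠ 0 := by norm_num
  have hC' : C⁻¹ • W = V.quadraticTwist (-3 : ℚ) := by rw [← hC, inv_smul_smul]
  obtain ⟨e, hpos, hneg⟩ := exists_signEquiv_of_twist (W := V) (Wd := W) (p := 3) hd0 C⁻¹ hC'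
  obtain ⟨X, hX, hXsub⟩ := hA
  obtain ⟨σ₁, hσ₁I, hσ₁⟩ := hI
  -- the transported line `L = e⁻¹(X)`
  set L : AddSubgroup (geomTorsion W ((3 : ℕ) : ℤ)) := X.map e.symm.toAddMonoidHom with hLdef
  have hmemL : ∀ P, P ∈ L ↔ e P ∈ X := fun P ↦ by
    rw [hLdef, AddSubgroup.mem_map_equiv, AddEquiv.symm_symm]
  have hL : Nat.card L = 3 :=
    (Nat.card_congr (X.equivMapOfInjective e.symm.toAddMonoidHom e.symm.injective).toEquiv).symm.trans
      hX
  refine ⟨L, hL, ?_, ?_⟩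
  · -- `I` fixes `L` pointwise: sign × scalar = 1
    intro σ hσ P hP
    rw [hmemL] at hP
    have hscal := smul_eq_cyclotomic_zsmul_of_forall_sub_mem V 3 σ hX (hXsub σ hσ) hP
    apply e.injective
    by_cases hs : σ • geomSqrt (-3 : ℚ) = geomSqrt (-3 : ℚ)
    · have h1 : modPCyclotomicCharacterZMod ℚ 3 σ = 1 := (smul_geomSqrt_neg_three_iff σ).mp hs
      rw [hpos σ hs, hscal, h1, Units.val_one, ZMod.val_one, Nat.cast_one, one_smul]
    · have h1 : modPCyclotomicCharacterZMod ℚ 3 σ ≠ 1 := fun h ↦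
        hs ((smul_geomSqrt_neg_three_iff σ).mpr h)
      rw [hneg σ hs, hscal, val_modPCyclotomicCharacterZMod_three_eq_two h1,
        two_zsmul_eq_neg_three, neg_neg]
  · -- `σ₁` moves `W[3]/L`
    obtain ⟨q₀, hq₀⟩ := exists_not_mem_of_natCard_eq hX
    have hs₁ : ¬ σ₁ • geomSqrt (-3 : ℚ) = geomSqrt (-3 : ℚ) := fun h ↦
      geomSqrt_ne_neg hd0 (h.symm.trans hσ₁)
    refine ⟨σ₁, hσ₁I, e.symm q₀, fun hmem ↦ hq₀ ?_⟩
    rw [hmemL, map_sub, AddEquiv.apply_symm_apply, hneg σ₁ hs₁, AddEquiv.apply_symm_apply] at hmem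
    -- `hmem : -(σ₁ • q₀) - q₀ ∈ X`; with `σ₁ • q₀ - q₀ ∈ X` this gives `(-2) • q₀ ∈ X`
    have h2 : (-2 : ℤ) • q₀ ∈ X := by
      have h := X.add_mem hmem (hXsub σ₁ hσ₁I q₀)
      have e1 : -(σ₁ • q₀) - q₀ + (σ₁ • q₀ - q₀) = (-2 : ℤ) • q₀ := by
        generalize σ₁ • q₀ = r
        module
      rwa [e1] at h
    exact mem_of_zsmul_mem (p := 3) (by decide) h2

omit [W.IsElliptic] in
/-- **TB-TOL on the `I₀*` rows (binder-free).** `V` globally minimal and GOOD ORDINARY at `3`,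
`W = C • V^{(−3)}`: at every inertia group `I_𝔓`, `𝔓 ∣ 3`, `W[3]` has the twisted-ordinary shape
(x1a's Serre §1.11 line of `V` + a Kummer inertia element with `σ√−3 = −√−3`, `ord₃(−3) = 1`).
[cite: Serre1972, §1.11 Prop. 11] [cite: Lang1983, Ch. 6 Prop. 1.3] -/
theorem twistedOrdinaryLineAt_three_of_goodOrd_twist_model {V : WeierstrassCurve ℚ} [V.IsElliptic]
    [V.IsGloballyMinimal] (hgood : V.HasGoodReductionAtPrime 3) (hord : ¬ (3 : ℤ) ∣ V.frobeniusTrace 3)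
    (C : VariableChange ℚ) (hC : C • V.quadraticTwist (-3 : ℚ) = W)
    {v : HeightOneSpectrum (𝓞 ℚ)} (hv : ((3 : ℕ) : 𝓞 ℚ) ∈ v.asIdeal)
    {𝔓 : Ideal (absIntegers (𝓞 ℚ) ℚ)} (h𝔓 : 𝔓 ∈ v.primesAbove) :
    TwistedOrdinaryLineAt W 3 (𝔓.inertia (absoluteGaloisGroup ℚ)) := by
  refine twistedOrdinaryLineAt_three_of_twist_model C hC ?_
    (unramifiedQuotientLineAt_of_goodOrdinary (by decide) hgood (by exact_mod_cast hord) hv h𝔓)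
  -- the Kummer inertia element
  have hγ : v.intValuation (((-3 : ℤ) : 𝓞 ℚ)) = WithZero.exp (-1 : ℤ) := by
    have h := intValuation_pStar 3 hv
    have e1 : ((((-1 : ℤ) ^ ((3 : ℕ) / 2) * (3 : ℕ) : ℤ)) : 𝓞 ℚ) = (((-3 : ℤ)) : 𝓞 ℚ) := by
      norm_num
    rwa [e1] at h
  have h2 : (2 : 𝓞 ℚ) ∉ v.asIdeal := two_not_mem_of_natCast_prime_mem (Fact.out) (by decide) hv
  obtain ⟨σ, hσI, hσ⟩ := exists_mem_inertia_smul_geomSqrt_eq_neg hγ h2 h𝔓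
  have hcoe : ((((-3 : ℤ) : 𝓞 ℚ) : 𝓞 ℚ) : ℚ) = (-3 : ℚ) := by
    rw [RingOfIntegers.coe_eq_algebraMap, map_intCast]
    norm_num
  rw [hcoe] at hσ
  exact ⟨σ, hσI, hσ⟩

omit [W.IsElliptic] in
/-- **TB-TOL on the (M) rows** (Tate uniformisation A40/A41 granted, as everywhere in the cell).
`V` globally minimal and MULTIPLICATIVE at `3`, `W = C • V^{(−3)}`: at the inertia group of the
tree's chosen prime above `3`, `W[3]` has the twisted-ordinary shape (X2's Tate line of `V` + the
Kummer inertia element). [cite: SilvermanATAEC1994, V.5.3 and V.5.4 (Tate uniformisation)]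
[cite: Lang1983, Ch. 6 Prop. 1.3] -/
theorem exists_twistedOrdinaryLineAt_three_of_mult_twist_model {V : WeierstrassCurve ℚ}
    [V.IsElliptic] [V.IsGloballyMinimal]
    (hT : Silverman1994_thmV53_tateUniformisation.{0})
    (hT' : Silverman1994_thmV53_corV54_tateUniformisation.{0})
    (hmult : V.HasMultiplicativeReductionAtPrime 3)
    (C : VariableChange ℚ) (hC : C • V.quadraticTwist (-3 : ℚ) = W) :
    ∃ (v : HeightOneSpectrum (𝓞 ℚ)), ((3 : ℕ) : 𝓞 ℚ) ∈ v.asIdeal ∧ ∃ 𝔓 ∈ v.primesAbove,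
      TwistedOrdinaryLineAt W 3 (𝔓.inertia (absoluteGaloisGroup ℚ)) := by
  obtain ⟨v, hv, 𝔓, h𝔓, hA⟩ :=
    exists_unramifiedQuotientLineAt_of_multiplicative (p := 3) hT hT' (by decide) hmult
  refine ⟨v, hv, 𝔓, h𝔓, twistedOrdinaryLineAt_three_of_twist_model C hC ?_ hA⟩
  have hγ : v.intValuation (((-3 : ℤ) : 𝓞 ℚ)) = WithZero.exp (-1 : ℤ) := by
    have h := intValuation_pStar 3 hv
    have e1 : ((((-1 : ℤ) ^ ((3 : ℕ) / 2) * (3 : ℕ) : ℤ)) : 𝓞 ℚ) = (((-3 : ℤ)) : 𝓞 ℚ) := by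
      norm_num
    rwa [e1] at h
  have h2 : (2 : 𝓞 ℚ) ∉ v.asIdeal := two_not_mem_of_natCast_prime_mem (Fact.out) (by decide) hv
  obtain ⟨σ, hσI, hσ⟩ := exists_mem_inertia_smul_geomSqrt_eq_neg hγ h2 h𝔓
  have hcoe : ((((-3 : ℤ) : 𝓞 ℚ) : 𝓞 ℚ) : ℚ) = (-3 : ℚ) := by
    rw [RingOfIntegers.coe_eq_algebraMap, map_intCast]
    norm_num
  rw [hcoe] at hσ
  exact ⟨σ, hσI, hσ⟩


/-! ## §4. Consequences: TAME with NO per-pair binder — O8's `I₀*` rows (unconditional) and (M) rows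
(Tate facts A40/A41); and the `hE` binder of `inertiaSplitAt_of_congruence` discharged -/

/-- **O8-TAME, binder-free on the `I₀*` rows.** An O8 pair at `3` (`ClassX4 W 3`, `¬ Surj W 3`)
whose curve is the `−3`-twist of a globally minimal GOOD ORDINARY `V` (`C • V^{(−3)} = W`): at every
inertia group above `3`, `E[3]|_{I_𝔓} ≅ χ ⊕ 1` SPLITS (`InertiaSplitAt W 3 I_𝔓`). TB-TOL (§3) +
`O8.inertiaSplitAt_of_twistedOrdinaryLineAt` (`GaloisImage/SmallImageTameInertia.lean`).
[cite: Serre1972, §1.11 Prop. 11 and §2.4 Prop. 15] -/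
theorem O8.inertiaSplitAt_three_of_goodOrd_twist_model (hX : ClassX4 W 3) (hns : ¬ Surj W 3)
    {V : WeierstrassCurve ℚ} [V.IsElliptic] [V.IsGloballyMinimal]
    (hgood : V.HasGoodReductionAtPrime 3) (hord : ¬ (3 : ℤ) ∣ V.frobeniusTrace 3)
    (C : VariableChange ℚ) (hC : C • V.quadraticTwist (-3 : ℚ) = W)
    {v : HeightOneSpectrum (𝓞 ℚ)} (hv : ((3 : ℕ) : 𝓞 ℚ) ∈ v.asIdeal)
    {𝔓 : Ideal (absIntegers (𝓞 ℚ) ℚ)} (h𝔓 : 𝔓 ∈ v.primesAbove) :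
    InertiaSplitAt W 3 (𝔓.inertia (absoluteGaloisGroup ℚ)) :=
  Additive.O8.inertiaSplitAt_of_twistedOrdinaryLineAt W 3 hX hns
    (twistedOrdinaryLineAt_three_of_goodOrd_twist_model hgood hord C hC hv h𝔓)

/-- **O8 ∩ X4♯(G-ord) ∩ `I₀*` at `3`: TAME is an unconditional theorem.** For `ClassX4Gord W 3` with
semistability defect `e = 2` (the `I₀*` rows) and `ρ̄_{E,3}` not onto, `E[3]|_{I_𝔓}` splits at every
inertia group above `3` — the twist model is the tree's
`ClassX4Gord.exists_goodOrd_pStar_twist_model`; NO binder, NO fact.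
[cite: Serre1972, §1.11 Prop. 11 and §2.4 Prop. 15] -/
theorem inertiaSplitAt_three_of_classX4Gord_of_not_surj [W.IsGloballyMinimal] (hX : ClassX4Gord W 3)
    (he : semistabilityIndex W 3 = 2) (hns : ¬ Surj W 3)
    {v : HeightOneSpectrum (𝓞 ℚ)} (hv : ((3 : ℕ) : 𝓞 ℚ) ∈ v.asIdeal)
    {𝔓 : Ideal (absIntegers (𝓞 ℚ) ℚ)} (h𝔓 : 𝔓 ∈ v.primesAbove) :
    InertiaSplitAt W 3 (𝔓.inertia (absoluteGaloisGroup ℚ)) := by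
  obtain ⟨V, iV, iVm, C, hgo, hC⟩ := ClassX4Gord.exists_goodOrd_pStar_twist_model W 3 hX he
  have h3 : ((-1 : ℚ) ^ ((3 : ℕ) / 2) * ((3 : ℕ) : ℚ)) = (-3 : ℚ) := by norm_num
  rw [h3] at hC
  exact O8.inertiaSplitAt_three_of_goodOrd_twist_model hX.classX4 hns hgo.1
    (by exact_mod_cast hgo.2) C hC hv h𝔓

/-- **O8-TAME on the (M) rows** (Tate uniformisation A40/A41 granted). An O8 pair at `3` whose curve
is the `−3`-twist of a globally minimal MULTIPLICATIVE `V`: at the inertia group of the tree's chosen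
prime above `3`, `E[3]|_{I_𝔓}` splits. [cite: SilvermanATAEC1994, V.5.3 and V.5.4 (Tate uniformisation)]
[cite: Serre1972, §2.4 Prop. 15] -/
theorem O8.exists_inertiaSplitAt_three_of_mult_twist_model (hX : ClassX4 W 3) (hns : ¬ Surj W 3)
    {V : WeierstrassCurve ℚ} [V.IsElliptic] [V.IsGloballyMinimal]
    (hT : Silverman1994_thmV53_tateUniformisation.{0})
    (hT' : Silverman1994_thmV53_corV54_tateUniformisation.{0})
    (hmult : V.HasMultiplicativeReductionAtPrime 3)
    (C : VariableChange ℚ) (hC : C • V.quadraticTwist (-3 : ℚ) = W) :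
    ∃ (v : HeightOneSpectrum (𝓞 ℚ)), ((3 : ℕ) : 𝓞 ℚ) ∈ v.asIdeal ∧ ∃ 𝔓 ∈ v.primesAbove,
      InertiaSplitAt W 3 (𝔓.inertia (absoluteGaloisGroup ℚ)) := by
  obtain ⟨v, hv, 𝔓, h𝔓, hE⟩ := exists_twistedOrdinaryLineAt_three_of_mult_twist_model hT hT' hmult C hC
  exact ⟨v, hv, 𝔓, h𝔓, Additive.O8.inertiaSplitAt_of_twistedOrdinaryLineAt W 3 hX hns hE⟩

/-- **O8 ∩ X4(M) at `3`: TAME modulo Tate uniformisation only.** For `ClassX4M W 3` with `ρ̄_{E,3}`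
not onto, some inertia group above `3` splits `E[3]` — the twist model is the tree's
`ClassX4M.exists_mult_pStar_twist_model`. [cite: SilvermanATAEC1994, V.5.3 and V.5.4 (Tate uniformisation)]
[cite: Serre1972, §2.4 Prop. 15] -/
theorem exists_inertiaSplitAt_three_of_classX4M_of_not_surj
    (hX : Summit.BirchSwinnertonDyer.Rank1Residual.AdditivePotMult.ClassX4M W 3) (hns : ¬ Surj W 3)
    (hT : Silverman1994_thmV53_tateUniformisation.{0})
    (hT' : Silverman1994_thmV53_corV54_tateUniformisation.{0}) :
    ∃ (v : HeightOneSpectrum (𝓞 ℚ)), ((3 : ℕ) : 𝓞 ℚ) ∈ v.asIdeal ∧ ∃ 𝔓 ∈ v.primesAbove,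
      InertiaSplitAt W 3 (𝔓.inertia (absoluteGaloisGroup ℚ)) := by
  obtain ⟨V, iV, iVm, C, hmV, hC⟩ := hX.exists_mult_pStar_twist_model
  have h3 : ((-1 : ℚ) ^ ((3 : ℕ) / 2) * ((3 : ℕ) : ℚ)) = (-3 : ℚ) := by norm_num
  rw [h3] at hC
  exact O8.exists_inertiaSplitAt_three_of_mult_twist_model hX.classX4 hns hT hT' hmV C hC

/-- **The `hE` binder of `inertiaSplitAt_of_congruence_of_goodOrdinary` (p258175) discharged:** a
`Γ_ℚ`-equivariant `E[3] ≃ E'[3]` between `E = C • V^{(−3)}` (`V` globally minimal, good ordinary at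
`3`: an `I₀*` row — surjective image allowed) and `E'` globally minimal GOOD ORDINARY at `3` forces
BOTH `E'[3]|_{I_𝔓}` and `E[3]|_{I_𝔓}` to split, at every inertia group above `3` — the local
consequence of every CERT-2 link with an `I₀*` row and a good partner, now with no shape binder.
[cite: Serre1972, §1.11 Prop. 11] [cite: Edixhoven1997Serre, §4.2 (PDF p. 297; companion forms)] -/
theorem inertiaSplitAt_of_congruence_of_goodOrdinary_of_goodOrd_twist_model
    {W' : WeierstrassCurve ℚ} [W'.IsElliptic] [W'.IsGloballyMinimal]
    (hgood' : W'.HasGoodReductionAtPrime 3) (hord' : ¬ (3 : ℤ) ∣ W'.frobeniusTrace 3)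
    {V : WeierstrassCurve ℚ} [V.IsElliptic] [V.IsGloballyMinimal]
    (hgood : V.HasGoodReductionAtPrime 3) (hord : ¬ (3 : ℤ) ∣ V.frobeniusTrace 3)
    (C : VariableChange ℚ) (hC : C • V.quadraticTwist (-3 : ℚ) = W)
    {v : HeightOneSpectrum (𝓞 ℚ)} (hv : ((3 : ℕ) : 𝓞 ℚ) ∈ v.asIdeal)
    {𝔓 : Ideal (absIntegers (𝓞 ℚ) ℚ)} (h𝔓 : 𝔓 ∈ v.primesAbove)
    (e : geomTorsion W ((3 : ℕ) : ℤ) ≃+ geomTorsion W' ((3 : ℕ) : ℤ))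
    (he : ∀ (σ : absoluteGaloisGroup ℚ) (P : geomTorsion W ((3 : ℕ) : ℤ)), e (σ • P) = σ • e P) :
    InertiaSplitAt W' 3 (𝔓.inertia (absoluteGaloisGroup ℚ)) ∧
      InertiaSplitAt W 3 (𝔓.inertia (absoluteGaloisGroup ℚ)) :=
  inertiaSplitAt_of_congruence_of_goodOrdinary (by decide) hgood' (by exact_mod_cast hord') hv h𝔓 e he
    (twistedOrdinaryLineAt_three_of_goodOrd_twist_model hgood hord C hC hv h𝔓)

end Summit.BirchSwinnertonDyer.Rank1Residual.Additive.MixedCongruence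

end
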